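import Summits.QuantumFields.YangMills.Theorems.BalabanUVNodesN15KingModelAnalyticDeterminantVolumeLawFine
import Summits.QuantumFields.YangMills.Theorems.BalabanUVNodesN15KingModelAnalyticDeterminantMonotone
import HarnessLib

/-!
# BalabanUVNodes ∕ N15 — THE KING-MODEL RUNG (PART Ϯ-c): THE VOLUME LAW FOR THE FINE NORMALISATION WITH THE BLOCK TERM — LOCALITY OF `ln det A₀(U)`,
# `A₀(U) = −cΔ_U + m² + a·Q(U)^*Q(U)`: if two unitary backgrounds agree off the bond set `Z`, `|ln det A₀(U) − ln det A₀(V)| ≤ (4c|n|²·G(0,0) + a|n|∕m²)·#Z` — the hopping part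
# through KATO + LOEWNER (`A₀(W)⁻¹ ⪯ M_W⁻¹`, so every entry of the full propagator is `≤ G(0,0)`), the block term through the DIAGONAL OF `Q·A₀⁻¹·Q^*` (each block whose contour
# meets `Z` costs at most `a|n|∕m²`; the others cancel exactly)
# (Track A, DAG node N15 = NE2; FAN-OUT v1.1 §N15 s3 «KING-MODEL RUNG … + what the curved case adds»; count-neutral)

HONEST FRAMING.  Count-neutral (cell `pub-ymgap`, seat `pub-ymgap-dag-n15-e` g54; `--supports stmt-QuantumFields-27247 --as helper` = K3ᴬ, KEY MAP v3).  King's one-level comparison model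
on `Tor (fine L M)` with Bałaban's covariant block mean `Q(U)` on a tree contour system `T` (PART Ϥ), `a ≥ 0`, `c ≥ 0`, `m² > 0`, unitary `U, V`, any fibre `𝕜ⁿ`.  NOT Bałaban's (3.42);
NOT King's multi-step `Z_k`; NOT a node discharge (N15 of record untouched); nothing continuum ∕ ℝ⁴ ∕ OS ∕ Clay.

THE MECHANISM.  `A₀(U) − A₀(V) = (M_U − M_V) + a·(P(U) − P(V))`, `P = Q^*Q` (Ϥ-d `fullOpU_eq`).  (i) HOPPING PART: PART Ϯ-b's bond-by-bond bound needs `‖G_{pq}‖ ≤ β` for the propagator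
the sandwich is evaluated at, here `G = A₀(W)⁻¹`, `W ∈ {U, V}`; there is NO Kato domination for `A₀` (the block penalty is not of Kato form, Ͱ-a HONEST SCOPE) — but `A₀(W) = M_W + a·P(W)` with
`P(W) ⪰ 0` gives `A₀(W)⁻¹ ⪯ M_W⁻¹` (Ϭ-k `posSemidef_inv_sub_inv_add_of_posSemidef`, [Bernstein2009] 8.10.8), the diagonal of `M_W⁻¹` is `≤ G(0,0)` by Kato, and a PSD matrix's entries are
dominated by its diagonal (Ϯ-a) ⟹ ★★ `norm_fullOpU_inv_entry_le_diag_zero`.  (ii) BLOCK PART: `tr(G·P(U′)) = tr(Q(U′)GQ(U′)^*) = Σ_p (Q(U′)GQ(U′)^*)_{pp}`; each diagonal entry lies in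
`[0, m⁻²]` (`G ⪰ 0` and `‖Gw‖ ≤ m⁻²‖w‖` from the mass floor, `L^{d+1}‖Q(U′)ᴴf‖² = ‖f‖²`, Ϥ-k); the row `(y,i)` of `Q(U′)` reads `U′` only on the contour bonds of block `y` (Ϥ-b
`treeHol_congr_block`), whose sources lie in block `y` — so for blocks not containing a source of `Z` the `U`- and `V`-terms CANCEL, and ★★ `abs_re_trace_mul_blockProjU_sub_le`:
`|Re tr(G(P(U) − P(V)))| ≤ |n|·#Z∕m²`.  (iii) Ϯ-b's two-sided engine ⟹ ★★★ **`abs_log_re_det_fullOpU_sub_le`** and ★★★ **`abs_log_re_det_fullOpU_sub_le_volume`**.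

PRIOR TREE ART (by name, not restated): Ϯ-a (`norm_entry_le_of_posSemidef_sub_of_re_diag_le`), Ϯ-b (`abs_log_re_det_sub_le_of_re_trace_le`, `abs_re_trace_mul_covLapF_sub_le`,
`norm_covLapF_inv_entry_le_diag_zero`, `sum_norm_link_sub_le_of_eqOn`), Ϭ-k (`posSemidef_inv_sub_inv_add_of_posSemidef`), Ϥ-b∕c∕d∕k (`treeHol_congr_block`, `covQ`, `kingQadjU`,
`blockProjU_eq_kingQadjU_mul`, `isHermitian_blockProjU`, `blockProjU_mul_self`, `fullOpU_eq`, `posDef_fullOpU_massive`, `re_quadForm_fullOpU_ge_mass`, `sum_norm_sq_conjTranspose_covQ_mulVec`,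
`re_quadForm_kingQadjU_sandwich`), Ͱ (`re_star_dotProduct_le_norm_mul_norm`, `sum_norm_fib_sq`), `King1986.Torus` (`site`, `blockOf_site`).  Dedup (rg at filing): basename 0 files;
`norm_toLp_fullOpU_inv_mulVec_le|norm_fullOpU_inv_entry_le_diag_zero|covQ_apply_congr_of_block|abs_re_trace_mul_blockProjU_sub_le|abs_log_re_det_fullOpU_sub_le|abs_log_re_det_fullOpU_sub_le_volume` 0 tree files.
Locators: [King1986] (2.11)–(2.14) p.653, (3.89)–(3.90) pp.668–669, (4.4)–(4.5) p.670; [Balaban1985BackgroundPropagators] (3.19) p.393, (3.23)–(3.25) p.394, (3.42) p.397; [Bernstein2009] Fact 8.10.8.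
0 `sorry`, 0 `def`.
-/

noncomputable section

open scoped BigOperators ComplexConjugate ComplexOrder
open Finset Matrix WithLp

namespace Summit.QuantumFields.YangMills.BalabanUVNodes.N15KingModelRung.Analytic

open Literature.MathematicalPhysics.QuantumFieldTheory.Balaban1983to89.B5Prop11Plancherel (Tor fine unitVec)
open Literature.MathematicalPhysics.QuantumFieldTheory.King1986.Torus (lapF site blockOf blockOf_site)
open Summit.QuantumFields.YangMills.BalabanUVNodes.N15KingModelRung.Covariant (covLapF posDef_covLapF re_star_dotProduct_le_norm_mul_norm sum_norm_fib_sq)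
open Summit.QuantumFields.YangMills.BalabanUVNodes.N15KingModelRung.CovariantBlock

variable {d : ℕ} {L : ℕ} [NeZero L] (T : BlockTree d L) (M : Fin (d + 1) → ℕ) [hM : ∀ μ, NeZero (M μ)]
variable {𝕜 : Type*} [RCLike 𝕜] {n : Type*} [Fintype n] [DecidableEq n]

/-! ## §1 The full propagator: mass floor, Loewner comparison with the minimally coupled covariance, entries `≤ G(0,0)` -/

section Propagator

variable {a c m2 : ℝ} (ha : 0 ≤ a) (hc : 0 ≤ c) (hm : 0 < m2)
variable {W : Tor (fine L M) × Fin (d + 1) → Matrix n n 𝕜} (hW : ∀ bd, W bd ∈ Matrix.unitaryGroup n 𝕜)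
include ha hc hm hW

/-- ★ THE MASS FLOOR OF THE FULL PROPAGATOR: `‖A₀(W)⁻¹w‖ ≤ m⁻²‖w‖` at every unitary `W` (`m²‖v‖² ≤ Re⟨v,A₀v⟩ = Re⟨v,w⟩ ≤ ‖v‖‖w‖` with `v = A₀⁻¹w`).
[cite: Balaban1985BackgroundPropagators, (3.24)–(3.25) p.394; King1986, (2.13) p.653] -/
theorem norm_toLp_fullOpU_inv_mulVec_le (w : Tor (fine L M) × n → 𝕜) :
    ‖(toLp 2 ((fullOpU T M a c m2 W)⁻¹ *ᵥ w) : EuclideanSpace 𝕜 (Tor (fine L M) × n))‖ ≤ m2⁻¹ * ‖(toLp 2 w : EuclideanSpace 𝕜 (Tor (fine L M) × n))‖ := by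
  set v := (fullOpU T M a c m2 W)⁻¹ *ᵥ w with hv
  have hdet : IsUnit (fullOpU T M a c m2 W).det := (Matrix.isUnit_iff_isUnit_det _).mp (isUnit_fullOpU_massive T M ha hc hm hW)
  have hMv : fullOpU T M a c m2 W *ᵥ v = w := by rw [hv, mulVec_mulVec, Matrix.mul_nonsing_inv _ hdet, one_mulVec]
  have h1 := re_quadForm_fullOpU_ge_mass T M ha hc m2 hW v
  rw [hMv, sum_norm_fib_sq] at h1
  have h2 := re_star_dotProduct_le_norm_mul_norm (fine L M) v w
  set A := ‖(toLp 2 v : EuclideanSpace 𝕜 (Tor (fine L M) × n))‖ with hA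
  set B := ‖(toLp 2 w : EuclideanSpace 𝕜 (Tor (fine L M) × n))‖ with hB
  have hA0 : 0 ≤ A := norm_nonneg _
  have hB0 : 0 ≤ B := norm_nonneg _
  rw [le_inv_mul_iff₀ hm]
  by_cases hz : A = 0
  · rw [hz, mul_zero]; exact hB0
  · have hApos : 0 < A := lt_of_le_of_ne hA0 (Ne.symm hz)
    nlinarith [h1, h2]

omit hc hm in
/-- The block penalty `a·Q(W)^*Q(W)` is positive semidefinite (`a ≥ 0`; `P = P² = Pᴴ` at unitary `W`). [cite: Balaban1985BackgroundPropagators, (3.24) p.394; King1986, (2.13) p.653] -/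
theorem posSemidef_smul_blockProjU : ((a : 𝕜) • blockProjU T M W).PosSemidef := by
  have hP : (blockProjU T M W).PosSemidef := by
    have h := posSemidef_conjTranspose_mul_self (blockProjU T M W)
    rwa [(isHermitian_blockProjU T M W).eq, blockProjU_mul_self T M hW] at h
  exact hP.smul (RCLike.ofReal_nonneg.mpr ha)

/-- ★ LOEWNER: `A₀(W)⁻¹ ⪯ M_W⁻¹` — adding the positive block penalty lowers the covariance ([Bernstein2009] 8.10.8, Ϭ-k `posSemidef_inv_sub_inv_add_of_posSemidef`).
[cite: Bernstein2009, Fact 8.10.8; King1986, (2.13) p.653; Balaban1985BackgroundPropagators, (3.24)–(3.25) p.394] -/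
theorem posSemidef_covLapF_inv_sub_fullOpU_inv : ((covLapF (fine L M) c m2 W)⁻¹ - (fullOpU T M a c m2 W)⁻¹).PosSemidef := by
  have h := posSemidef_inv_sub_inv_add_of_posSemidef (posDef_covLapF (fine L M) hc hm hW) (posSemidef_smul_blockProjU T M ha hW)
  rwa [← fullOpU_eq] at h

/-- ★★ **EVERY ENTRY OF THE FULL PROPAGATOR IS `≤ G(0,0)`**: `‖A₀(W)⁻¹_{pq}‖ ≤ (lapF)⁻¹(0,0)` at every unitary `W` — `A₀⁻¹ ⪰ 0`, `A₀⁻¹ ⪯ M⁻¹`, the diagonal of `M⁻¹` is `≤ G(0,0)` by Kato (Ϯ-b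
`norm_covLapF_inv_entry_le_diag_zero`), and a PSD matrix's entries are dominated by its diagonal (Ϯ-a). [cite: King1986, (2.13) p.653, (4.4) p.670, (4.35) p.674; Balaban1985BackgroundPropagators, (3.42) p.397] -/
theorem norm_fullOpU_inv_entry_le_diag_zero (p q : Tor (fine L M) × n) : ‖(fullOpU T M a c m2 W)⁻¹ p q‖ ≤ (lapF (fine L M) c m2)⁻¹ 0 0 :=
  norm_entry_le_of_posSemidef_sub_of_re_diag_le (posDef_fullOpU_massive T M ha hc hm hW).inv.posSemidef (posSemidef_covLapF_inv_sub_fullOpU_inv T M ha hc hm hW)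
    (fun p' => (RCLike.re_le_norm _).trans (norm_covLapF_inv_entry_le_diag_zero (fine L M) hc hm hW p' p')) p q

end Propagator

/-! ## §2 The block term: `tr(G·Q^*Q) = Σ_p (QGQ^*)_{pp}`, each diagonal entry in `[0, m⁻²]`, and locality of the rows of `Q` -/

section BlockTerm

variable {a c m2 : ℝ} (ha : 0 ≤ a) (hc : 0 ≤ c) (hm : 0 < m2)

/-- `tr(G·P(U′)) = tr(Q(U′)·G·Q(U′)^*)` (cyclicity; `P = Q^*Q`). [cite: King1986, (2.13) p.653; Balaban1985BackgroundPropagators, (3.19) p.393] -/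
theorem trace_mul_blockProjU_eq (G : Matrix (Tor (fine L M) × n) (Tor (fine L M) × n) 𝕜) (U' : Tor (fine L M) × Fin (d + 1) → Matrix n n 𝕜) :
    (G * blockProjU T M U').trace = (covQ T M U' * G * kingQadjU T M U').trace := by
  rw [blockProjU_eq_kingQadjU_mul, Matrix.trace_mul_cycle, Matrix.trace_mul_comm]

/-- The diagonal entry `(QGQ^*)_{pp}` is the form `⟨e_p, QGQ^*e_p⟩`. [folklore] -/
theorem sandwich_diag_eq_quadForm (X : Matrix (Tor M × n) (Tor M × n) 𝕜) (p : Tor M × n) :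
    X p p = star (Pi.single p (1 : 𝕜)) ⬝ᵥ (X *ᵥ Pi.single p 1) := by
  rw [Matrix.mulVec_single_one, ← Pi.single_star, star_one, single_one_dotProduct]
  rfl

/-- `‖e_p‖ = 1` in `ℓ²`. [folklore] -/
theorem norm_toLp_single_one (p : Tor M × n) : ‖(toLp 2 (Pi.single p (1 : 𝕜)) : EuclideanSpace 𝕜 (Tor M × n))‖ = 1 := by
  rw [EuclideanSpace.norm_eq]
  have : ∀ q : Tor M × n, ‖(toLp 2 (Pi.single p (1 : 𝕜)) : EuclideanSpace 𝕜 (Tor M × n)) q‖ ^ 2 = if q = p then 1 else 0 := fun q => by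
    rw [PiLp.toLp_apply, Pi.single_apply]; split_ifs <;> simp
  rw [Finset.sum_congr rfl fun q _ => this q, Finset.sum_ite_eq' Finset.univ p, if_pos (Finset.mem_univ _), Real.sqrt_one]

variable {W : Tor (fine L M) × Fin (d + 1) → Matrix n n 𝕜} (hW : ∀ bd, W bd ∈ Matrix.unitaryGroup n 𝕜)
include ha hc hm hW

/-- ★ `0 ≤ Re(Q(U′)A₀(W)⁻¹Q(U′)^*)_{pp} ≤ m⁻²` for unitary `U′, W`: positivity of `A₀⁻¹` and the mass floor `‖A₀⁻¹w‖ ≤ m⁻²‖w‖` through King's `η`-adjoint (`L^{d+1}‖Qᴴe_p‖² = 1`).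
[cite: King1986, (2.13) p.653, (4.5) p.670; Balaban1985BackgroundPropagators, (3.19) p.393, (3.24)–(3.25) p.394] -/
theorem re_sandwich_diag_mem_Icc {U' : Tor (fine L M) × Fin (d + 1) → Matrix n n 𝕜} (hU' : ∀ bd, U' bd ∈ Matrix.unitaryGroup n 𝕜) (p : Tor M × n) :
    RCLike.re ((covQ T M U' * (fullOpU T M a c m2 W)⁻¹ * kingQadjU T M U') p p) ∈ Set.Icc 0 m2⁻¹ := by
  rw [sandwich_diag_eq_quadForm M (covQ T M U' * (fullOpU T M a c m2 W)⁻¹ * kingQadjU T M U') p, re_quadForm_kingQadjU_sandwich]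
  set G := (fullOpU T M a c m2 W)⁻¹ with hG
  set f : Tor M × n → 𝕜 := Pi.single p 1 with hf
  set w := (covQ T M U')ᴴ *ᵥ f with hw
  have hL0 : (0 : ℝ) ≤ (L : ℝ) ^ (d + 1) := by positivity
  have hw2 := sum_norm_sq_conjTranspose_covQ_mulVec T M hU' f
  rw [← hw, hf, norm_toLp_single_one M p, one_pow] at hw2
  constructor
  · exact mul_nonneg hL0 ((posDef_fullOpU_massive T M ha hc hm hW).inv.posSemidef.re_dotProduct_nonneg w)
  · have hCS := re_star_dotProduct_le_norm_mul_norm (fine L M) w (G *ᵥ w)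
    have hinv := norm_toLp_fullOpU_inv_mulVec_le T M ha hc hm hW w
    set A := ‖(toLp 2 w : EuclideanSpace 𝕜 (Tor (fine L M) × n))‖ with hA
    have hA0 : 0 ≤ A := norm_nonneg _
    have h1 : RCLike.re (star w ⬝ᵥ (G *ᵥ w)) ≤ m2⁻¹ * A ^ 2 := by
      calc RCLike.re (star w ⬝ᵥ (G *ᵥ w)) ≤ A * ‖(toLp 2 (G *ᵥ w) : EuclideanSpace 𝕜 (Tor (fine L M) × n))‖ := hCS
        _ ≤ A * (m2⁻¹ * A) := mul_le_mul_of_nonneg_left hinv hA0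
        _ = m2⁻¹ * A ^ 2 := by ring
    calc (L : ℝ) ^ (d + 1) * RCLike.re (star w ⬝ᵥ (G *ᵥ w)) ≤ (L : ℝ) ^ (d + 1) * (m2⁻¹ * A ^ 2) := mul_le_mul_of_nonneg_left h1 hL0
      _ = m2⁻¹ * ((L : ℝ) ^ (d + 1) * A ^ 2) := by ring
      _ = m2⁻¹ := by rw [hw2, mul_one]

omit hM ha hc hm hW in
/-- ★ LOCALITY OF THE ROWS OF `Q`: if `U` and `V` agree on every contour bond of block `y`, the rows `(y,·)` of `Q(U)` and `Q(V)` coincide (Ϥ-b `treeHol_congr_block`).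
[cite: Balaban1985BackgroundPropagators, (3.19) p.393; King1986, (2.11)–(2.12) p.653] -/
theorem covQ_apply_congr_of_block {U V : Tor (fine L M) × Fin (d + 1) → Matrix n n 𝕜} (y : Tor M)
    (h : ∀ j, j ≠ T.root → U (site L M y (T.parent j), T.axis j) = V (site L M y (T.parent j), T.axis j)) (i : n) (q : Tor (fine L M) × n) :
    covQ T M U (y, i) q = covQ T M V (y, i) q := by
  simp only [covQ]
  refine Finset.sum_congr rfl fun j _ => ?_
  rw [treeHol_congr_block T M y h j]

omit ha hc hm hW in
/-- … hence the diagonal entries `(Q(U)GQ(U)^*)_{pp}` and `(Q(V)GQ(V)^*)_{pp}`, `p = (y,i)`, coincide for such blocks (they read only the row `p` of `Q`). [cite: Balaban1985BackgroundPropagators, (3.19) p.393] -/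
theorem sandwich_diag_congr_of_block (G : Matrix (Tor (fine L M) × n) (Tor (fine L M) × n) 𝕜) {U V : Tor (fine L M) × Fin (d + 1) → Matrix n n 𝕜} (y : Tor M)
    (h : ∀ j, j ≠ T.root → U (site L M y (T.parent j), T.axis j) = V (site L M y (T.parent j), T.axis j)) (i : n) :
    (covQ T M U * G * kingQadjU T M U) (y, i) (y, i) = (covQ T M V * G * kingQadjU T M V) (y, i) (y, i) := by
  simp only [kingQadjU, Matrix.mul_apply, Matrix.smul_apply, Matrix.conjTranspose_apply, covQ_apply_congr_of_block T M y h i]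

/-- ★★ **THE BLOCK TERM IS LOCAL**: if `U = V` off the bond set `Z`, then for `G = A₀(W)⁻¹` (any unitary `W`)
`|Re tr(G·(P(U) − P(V)))| ≤ |n|·#Z∕m²` — only the blocks containing a source of a bond of `Z` contribute, each diagonal entry by at most `m⁻²`.
[cite: King1986, (2.11)–(2.13) p.653, (4.5) p.670; Balaban1985BackgroundPropagators, (3.19) p.393, (3.24)–(3.25) p.394] -/
theorem abs_re_trace_mul_blockProjU_sub_le {U V : Tor (fine L M) × Fin (d + 1) → Matrix n n 𝕜} (hU : ∀ bd, U bd ∈ Matrix.unitaryGroup n 𝕜) (hV : ∀ bd, V bd ∈ Matrix.unitaryGroup n 𝕜)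
    {Z : Finset (Tor (fine L M) × Fin (d + 1))} (hZ : ∀ bd, bd ∉ Z → U bd = V bd) :
    |RCLike.re ((fullOpU T M a c m2 W)⁻¹ * (blockProjU T M U - blockProjU T M V)).trace| ≤ (Fintype.card n : ℝ) * Z.card * m2⁻¹ := by
  classical
  set G := (fullOpU T M a c m2 W)⁻¹ with hG
  set XU := covQ T M U * G * kingQadjU T M U with hXU
  set XV := covQ T M V * G * kingQadjU T M V with hXV
  set A : Finset (Tor M) := Z.image (fun bd => blockOf L M bd.1) with hA
  have htr : RCLike.re (G * (blockProjU T M U - blockProjU T M V)).trace = ∑ p : Tor M × n, (RCLike.re (XU p p) - RCLike.re (XV p p)) := by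
    rw [Matrix.mul_sub, Matrix.trace_sub, trace_mul_blockProjU_eq, trace_mul_blockProjU_eq, map_sub, Matrix.trace, Matrix.trace, map_sum, map_sum, ← Finset.sum_sub_distrib]
    rfl
  -- off the affected blocks the terms cancel
  have hcancel : ∀ p : Tor M × n, p.1 ∉ A → RCLike.re (XU p p) - RCLike.re (XV p p) = 0 := by
    rintro ⟨y, i⟩ hy
    have hrow : ∀ j, j ≠ T.root → U (site L M y (T.parent j), T.axis j) = V (site L M y (T.parent j), T.axis j) := by
      intro j _
      apply hZ
      intro hmem
      exact hy (Finset.mem_image.mpr ⟨_, hmem, blockOf_site L M y (T.parent j)⟩)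
    rw [hXU, hXV, sandwich_diag_congr_of_block T M G y hrow i, sub_self]
  have hsplit : ∑ p : Tor M × n, (RCLike.re (XU p p) - RCLike.re (XV p p))
      = ∑ p ∈ (Finset.univ : Finset (Tor M × n)).filter (fun p => p.1 ∈ A), (RCLike.re (XU p p) - RCLike.re (XV p p)) := by
    rw [Finset.sum_filter_of_ne]
    intro p _ hp
    by_contra h
    exact hp (hcancel p h)
  have hterm : ∀ p : Tor M × n, |RCLike.re (XU p p) - RCLike.re (XV p p)| ≤ m2⁻¹ := by
    intro p
    have hUp := re_sandwich_diag_mem_Icc T M ha hc hm hW hU p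
    have hVp := re_sandwich_diag_mem_Icc T M ha hc hm hW hV p
    rw [← hXU] at hUp
    rw [← hXV] at hVp
    rw [abs_le]
    constructor <;> linarith [hUp.1, hUp.2, hVp.1, hVp.2]
  have hcard : (((Finset.univ : Finset (Tor M × n)).filter (fun p => p.1 ∈ A)).card : ℝ) ≤ (Fintype.card n : ℝ) * Z.card := by
    have h1 : (Finset.univ : Finset (Tor M × n)).filter (fun p => p.1 ∈ A) = A ×ˢ (Finset.univ : Finset n) := by
      ext p
      simp [Finset.mem_product]
    rw [h1, Finset.card_product, Finset.card_univ, Nat.cast_mul]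
    have hA' : (A.card : ℝ) ≤ Z.card := by exact_mod_cast Finset.card_image_le
    nlinarith [hA', (Nat.cast_nonneg (Fintype.card n) : (0 : ℝ) ≤ _)]
  rw [htr, hsplit]
  calc |∑ p ∈ (Finset.univ : Finset (Tor M × n)).filter (fun p => p.1 ∈ A), (RCLike.re (XU p p) - RCLike.re (XV p p))|
      ≤ ∑ p ∈ (Finset.univ : Finset (Tor M × n)).filter (fun p => p.1 ∈ A), |RCLike.re (XU p p) - RCLike.re (XV p p)| := Finset.abs_sum_le_sum_abs _ _
    _ ≤ ∑ _p ∈ (Finset.univ : Finset (Tor M × n)).filter (fun p => p.1 ∈ A), m2⁻¹ := Finset.sum_le_sum fun p _ => hterm p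
    _ = (((Finset.univ : Finset (Tor M × n)).filter (fun p => p.1 ∈ A)).card : ℝ) * m2⁻¹ := by rw [Finset.sum_const, nsmul_eq_mul]
    _ ≤ (Fintype.card n : ℝ) * Z.card * m2⁻¹ := mul_le_mul_of_nonneg_right hcard (inv_nonneg.mpr hm.le)

end BlockTerm

/-! ## §3 The volume law for `ln det A₀(U)` -/

section Volume

variable {a c m2 : ℝ} (ha : 0 ≤ a) (hc : 0 ≤ c) (hm : 0 < m2)
variable {U V : Tor (fine L M) × Fin (d + 1) → Matrix n n 𝕜} (hU : ∀ bd, U bd ∈ Matrix.unitaryGroup n 𝕜) (hV : ∀ bd, V bd ∈ Matrix.unitaryGroup n 𝕜)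
include ha hc hm hU hV

/-- ★ THE RESPONSE OF `ln det A₀` AGAINST A LOCAL CHANGE, at the propagator of either endpoint `W ∈ {U, V}`:
`|Re tr(A₀(W)⁻¹(A₀(U) − A₀(V)))| ≤ 2c·G(0,0)·‖U−V‖_{ℓ¹} + a·|n|·#Z∕m²`. [cite: King1986, (2.13) p.653, (3.94)–(3.96) p.669; Balaban1985BackgroundPropagators, (3.23)–(3.25) p.394, (3.42) p.397] -/
theorem abs_re_trace_fullOpU_inv_mul_sub_le {W : Tor (fine L M) × Fin (d + 1) → Matrix n n 𝕜} (hW : ∀ bd, W bd ∈ Matrix.unitaryGroup n 𝕜)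
    {Z : Finset (Tor (fine L M) × Fin (d + 1))} (hZ : ∀ bd, bd ∉ Z → U bd = V bd) :
    |RCLike.re ((fullOpU T M a c m2 W)⁻¹ * (fullOpU T M a c m2 U - fullOpU T M a c m2 V)).trace|
      ≤ 2 * c * (lapF (fine L M) c m2)⁻¹ 0 0 * (∑ b, ∑ i, ∑ j, ‖U b i j - V b i j‖) + a * ((Fintype.card n : ℝ) * Z.card * m2⁻¹) := by
  have hsplit : fullOpU T M a c m2 U - fullOpU T M a c m2 V
      = (covLapF (fine L M) c m2 U - covLapF (fine L M) c m2 V) + (a : 𝕜) • (blockProjU T M U - blockProjU T M V) := by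
    rw [fullOpU_eq, fullOpU_eq, smul_sub]; abel
  rw [hsplit, Matrix.mul_add, Matrix.trace_add, map_add, Matrix.mul_smul, Matrix.trace_smul, smul_eq_mul, RCLike.re_ofReal_mul]
  refine (abs_add_le _ _).trans (add_le_add ?_ ?_)
  · exact abs_re_trace_mul_covLapF_sub_le (fine L M) (norm_fullOpU_inv_entry_le_diag_zero T M ha hc hm hW) hc m2 U V
  · rw [abs_mul, abs_of_nonneg ha]
    exact mul_le_mul_of_nonneg_left (abs_re_trace_mul_blockProjU_sub_le T M ha hc hm hW hU hV hZ) ha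

/-- ★★★ **THE VOLUME LAW FOR THE FINE NORMALISATION WITH THE BLOCK TERM, ℓ¹ FORM**: if `U = V` off `Z` (unitary backgrounds),
`|ln det A₀(U) − ln det A₀(V)| ≤ 2c·G(0,0)·‖U−V‖_{ℓ¹} + a·|n|·#Z∕m²`. [cite: King1986, (2.13)–(2.14) p.653, (3.89)–(3.90) pp.668–669; Balaban1985BackgroundPropagators, (3.23)–(3.25) p.394, (3.42) p.397] -/
theorem abs_log_re_det_fullOpU_sub_le {Z : Finset (Tor (fine L M) × Fin (d + 1))} (hZ : ∀ bd, bd ∉ Z → U bd = V bd) :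
    |Real.log (RCLike.re (fullOpU T M a c m2 U).det) - Real.log (RCLike.re (fullOpU T M a c m2 V).det)|
      ≤ 2 * c * (lapF (fine L M) c m2)⁻¹ 0 0 * (∑ b, ∑ i, ∑ j, ‖U b i j - V b i j‖) + a * ((Fintype.card n : ℝ) * Z.card * m2⁻¹) :=
  abs_log_re_det_sub_le_of_re_trace_le (posDef_fullOpU_massive T M ha hc hm hV) (posDef_fullOpU_massive T M ha hc hm hU)
    (abs_re_trace_fullOpU_inv_mul_sub_le T M ha hc hm hU hV hV hZ) (abs_re_trace_fullOpU_inv_mul_sub_le T M ha hc hm hU hV hU hZ)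

/-- ★★★ **THE VOLUME LAW FOR `ln det A₀(U)`**: if two unitary backgrounds agree off the bond set `Z`, then
`|ln det A₀(U) − ln det A₀(V)| ≤ (4c·|n|²·G(0,0) + a·|n|∕m²)·#Z` — proportional to the number of changed bonds; the hopping part carries King's coincident-point covariance `c·G(0,0)`,
the block part the mass floor `a∕m²`. [cite: King1986, (2.13)–(2.14) p.653, (3.89)–(3.90) pp.668–669, (4.4)–(4.5) p.670; Balaban1985BackgroundPropagators, (3.19) p.393, (3.23)–(3.25) p.394, (3.42) p.397] -/
theorem abs_log_re_det_fullOpU_sub_le_volume {Z : Finset (Tor (fine L M) × Fin (d + 1))} (hZ : ∀ bd, bd ∉ Z → U bd = V bd) :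
    |Real.log (RCLike.re (fullOpU T M a c m2 U).det) - Real.log (RCLike.re (fullOpU T M a c m2 V).det)|
      ≤ (4 * c * (Fintype.card n : ℝ) ^ 2 * (lapF (fine L M) c m2)⁻¹ 0 0 + a * (Fintype.card n : ℝ) * m2⁻¹) * Z.card := by
  have hG : 0 ≤ (lapF (fine L M) c m2)⁻¹ (0 : Tor (fine L M)) 0 := Covariant.lapF_inv_entry_nonneg (fine L M) hc hm 0 0
  have h1 := abs_log_re_det_fullOpU_sub_le T M ha hc hm hU hV hZ
  have h2 := sum_norm_link_sub_le_of_eqOn (fine L M) hU hV hZ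
  have h3 : 2 * c * (lapF (fine L M) c m2)⁻¹ 0 0 * (∑ b, ∑ i, ∑ j, ‖U b i j - V b i j‖)
      ≤ 2 * c * (lapF (fine L M) c m2)⁻¹ 0 0 * (2 * (Fintype.card n : ℝ) ^ 2 * Z.card) := mul_le_mul_of_nonneg_left h2 (by positivity)
  calc |Real.log (RCLike.re (fullOpU T M a c m2 U).det) - Real.log (RCLike.re (fullOpU T M a c m2 V).det)|
      ≤ 2 * c * (lapF (fine L M) c m2)⁻¹ 0 0 * (2 * (Fintype.card n : ℝ) ^ 2 * Z.card) + a * ((Fintype.card n : ℝ) * Z.card * m2⁻¹) := h1.trans (add_le_add h3 le_rfl)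
    _ = (4 * c * (Fintype.card n : ℝ) ^ 2 * (lapF (fine L M) c m2)⁻¹ 0 0 + a * (Fintype.card n : ℝ) * m2⁻¹) * Z.card := by ring

end Volume

end Summit.QuantumFields.YangMills.BalabanUVNodes.N15KingModelRung.Analytic

end
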